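import Mathlib.Analysis.SpecialFunctions.Pow.Real
import Mathlib.Algebra.Order.Field.GeomSum
import HarnessLib

/-!
# Crux `NestingRigidity`, line `pinch-resampling` (v4), stub S12: counting lemmas of the necklace summation — free slots and the gap code

Crux `Summit.CriticalPhenomena.CardyFormulaZ2.Theses.CardyMagicRigidity.NestingRigidity`
(stmt-CriticalPhenomena-4835), line `pinch-resampling` v4, stub S12 `stub_neckHookupCoarseZ2 : NeckHookupCoarseZ2`.
Two pure counting bricks of the summation of the necklace bound `ZNodeAbsBoundChainA` (amended plan in the module
docstring of `…NestingRigidityGapEntropy`, worker W6a), with Mathlib-only imports.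

* §1 **Free slots** (`sum_card_freeSlots_ge`, registered anchor `skeleton_free_slots`): the ADMISSIBILITY
  constraint of a necklace skeleton.  Abstractly: cells `A`, good nodes `𝒢`, `Jz` slots per cell, a conflict
  relation with at most two cells in conflict with each node (`…NeckZ2SkeletonArms`: the big clusters chosen on `A`
  are distinct and a node has two crossing clusters), and for each conflicting pair a set of blocked slots of size
  `≤ β Q` (`…NeckZ2SkeletonSlots`: `β Q = log₂ (ρ_Q/8 + 1)/K + 2`).  The FREE slots of `m` (those blocked by no node
  in conflict with `m`) then number, in total over `A`, at least `|A| Jz - 2 Σ_{Q ∈ 𝒢} β Q`.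
* §2 **The gap code** (`sum_rpow_neg_le`): `Σ_{1 ≤ g ≤ N} g^{-(1+δ)} ≤ 1 / (1 - 2^{-δ})` for `δ > 0` (dyadic
  blocks), the Kraft inequality behind the code weight `∝ g^{-(1+δ)}` of a gap in the union bound over skeletons.
-/

noncomputable section

namespace Summit.CriticalPhenomena.CardyFormulaZ2.Cruxes.NestingRigidity.PinchResampling

open Finset

/-! ## §1 Free slots -/

/-- **Free slots of one cell**: the slots `z < Jz` blocked by no conflicting node number at least
`Jz - Σ_{Q ∈ 𝒢, conflict} |blocked Q ∩ [0, Jz)|`. -/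
theorem card_freeSlots_ge {κ : Type*} (𝒢 : Finset κ) (Jz : ℕ) (conflict : κ → Prop) [DecidablePred conflict]
    (blocked : κ → Finset ℕ) :
    (Jz : ℝ) - ∑ Q ∈ 𝒢.filter conflict, (((range Jz).filter (· ∈ blocked Q)).card : ℝ) ≤
      (((range Jz).filter fun z ↦ ∀ Q ∈ 𝒢, conflict Q → z ∉ blocked Q).card : ℝ) := by
  classical
  -- the blocked slots are covered by the blocked sets of the conflicting nodes
  have hcover : (range Jz).filter (fun z ↦ ¬ ∀ Q ∈ 𝒢, conflict Q → z ∉ blocked Q) ⊆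
      (𝒢.filter conflict).biUnion fun Q ↦ (range Jz).filter (· ∈ blocked Q) := by
    intro z hz
    simp only [mem_filter, not_forall, not_not, exists_prop] at hz
    obtain ⟨hzJ, Q, hQ, hc, hzb⟩ := hz
    exact mem_biUnion.2 ⟨Q, mem_filter.2 ⟨hQ, hc⟩, mem_filter.2 ⟨hzJ, hzb⟩⟩
  have hsplit := Finset.card_filter_add_card_filter_not (s := range Jz)
    (fun z ↦ ∀ Q ∈ 𝒢, conflict Q → z ∉ blocked Q)
  rw [card_range] at hsplit
  have hle := (card_le_card hcover).trans card_biUnion_le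
  have h1 : (Jz : ℝ) = (((range Jz).filter fun z ↦ ∀ Q ∈ 𝒢, conflict Q → z ∉ blocked Q).card : ℝ) +
      (((range Jz).filter fun z ↦ ¬ ∀ Q ∈ 𝒢, conflict Q → z ∉ blocked Q).card : ℝ) := by
    exact_mod_cast hsplit.symm
  have h2 : (((range Jz).filter fun z ↦ ¬ ∀ Q ∈ 𝒢, conflict Q → z ∉ blocked Q).card : ℝ) ≤
      ∑ Q ∈ 𝒢.filter conflict, (((range Jz).filter (· ∈ blocked Q)).card : ℝ) := by
    exact_mod_cast hle
  linarith

/-- **Free slots in total (the admissibility constraint).**  If every node is in conflict with at most two cells of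
`A`, and a conflicting node `Q` blocks at most `β Q ≥ 0` slots of a cell, then the free slots number in total at least
`|A| Jz - 2 Σ_{Q ∈ 𝒢} β Q`. -/
theorem sum_card_freeSlots_ge {ι κ : Type*} (A : Finset ι) (𝒢 : Finset κ) (Jz : ℕ) (conflict : ι → κ → Prop)
    [∀ m, DecidablePred (conflict m)] (blocked : ι → κ → Finset ℕ) (β : κ → ℝ) (hβ0 : ∀ Q ∈ 𝒢, 0 ≤ β Q)
    (hβ : ∀ m ∈ A, ∀ Q ∈ 𝒢, conflict m Q → (((range Jz).filter (· ∈ blocked m Q)).card : ℝ) ≤ β Q)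
    (hconf : ∀ Q ∈ 𝒢, (A.filter fun m ↦ conflict m Q).card ≤ 2) :
    (A.card : ℝ) * Jz - 2 * ∑ Q ∈ 𝒢, β Q ≤
      ∑ m ∈ A, (((range Jz).filter fun z ↦ ∀ Q ∈ 𝒢, conflict m Q → z ∉ blocked m Q).card : ℝ) := by
  classical
  -- per cell
  have hcell : ∀ m ∈ A, (Jz : ℝ) - ∑ Q ∈ 𝒢, (if conflict m Q then β Q else 0) ≤
      (((range Jz).filter fun z ↦ ∀ Q ∈ 𝒢, conflict m Q → z ∉ blocked m Q).card : ℝ) := by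
    intro m hm
    have h := card_freeSlots_ge 𝒢 Jz (conflict m) (blocked m)
    have h' : ∑ Q ∈ 𝒢.filter (conflict m), (((range Jz).filter (· ∈ blocked m Q)).card : ℝ) ≤
        ∑ Q ∈ 𝒢, (if conflict m Q then β Q else 0) := by
      rw [← sum_filter]
      exact sum_le_sum fun Q hQ ↦ hβ m hm Q (mem_filter.1 hQ).1 (mem_filter.1 hQ).2
    linarith
  -- summing and swapping
  have hswap : ∑ m ∈ A, ∑ Q ∈ 𝒢, (if conflict m Q then β Q else 0) ≤ 2 * ∑ Q ∈ 𝒢, β Q := by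
    rw [sum_comm, mul_sum]
    refine sum_le_sum fun Q hQ ↦ ?_
    rw [← sum_filter, sum_const, nsmul_eq_mul]
    have : ((A.filter fun m ↦ conflict m Q).card : ℝ) ≤ 2 := by exact_mod_cast hconf Q hQ
    nlinarith [hβ0 Q hQ]
  calc (A.card : ℝ) * Jz - 2 * ∑ Q ∈ 𝒢, β Q
      ≤ ∑ m ∈ A, ((Jz : ℝ) - ∑ Q ∈ 𝒢, (if conflict m Q then β Q else 0)) := by
        rw [sum_sub_distrib, sum_const, nsmul_eq_mul]
        linarith
    _ ≤ _ := sum_le_sum hcell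

/-! ## §2 The gap code -/

/-- A dyadic block: `Σ_{2^j ≤ g < 2^{j+1}} g^{-(1+δ)} ≤ (2^{-δ})^j` for `δ ≥ 0`. -/
theorem sum_Ico_pow_rpow_neg_le {δ : ℝ} (hδ : 0 ≤ δ) (j : ℕ) :
    ∑ g ∈ Ico (2 ^ j) (2 ^ (j + 1)), ((g : ℕ) : ℝ) ^ (-(1 + δ)) ≤ ((2 : ℝ) ^ (-δ)) ^ j := by
  have h2j : (0 : ℝ) < (2 : ℝ) ^ j := by positivity
  calc ∑ g ∈ Ico (2 ^ j) (2 ^ (j + 1)), ((g : ℕ) : ℝ) ^ (-(1 + δ))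
      ≤ ∑ _g ∈ Ico (2 ^ j) (2 ^ (j + 1)), ((2 : ℝ) ^ j) ^ (-(1 + δ)) := by
        refine sum_le_sum fun g hg ↦ ?_
        have hg' : (2 : ℝ) ^ j ≤ (g : ℝ) := by exact_mod_cast (mem_Ico.1 hg).1
        exact Real.rpow_le_rpow_of_nonpos h2j hg' (by linarith)
    _ = (2 ^ j : ℕ) * ((2 : ℝ) ^ j) ^ (-(1 + δ)) := by
        rw [sum_const, Nat.card_Ico, show 2 ^ (j + 1) - 2 ^ j = 2 ^ j by rw [pow_succ]; omega, nsmul_eq_mul]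
    _ = ((2 : ℝ) ^ (-δ)) ^ j := by
        push_cast
        rw [← Real.rpow_natCast ((2 : ℝ) ^ (-δ)) j, ← Real.rpow_mul (by norm_num), ← Real.rpow_natCast 2 j,
          ← Real.rpow_mul (by norm_num), ← Real.rpow_add (by norm_num)]
        congr 1
        ring

/-- **The Kraft inequality of the gap code**: `Σ_{1 ≤ g ≤ N} g^{-(1+δ)} ≤ 1 / (1 - 2^{-δ})` for `δ > 0`. -/
theorem sum_rpow_neg_le {δ : ℝ} (hδ : 0 < δ) (N : ℕ) :
    ∑ g ∈ Icc 1 N, ((g : ℕ) : ℝ) ^ (-(1 + δ)) ≤ 1 / (1 - (2 : ℝ) ^ (-δ)) := by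
  have hr0 : 0 ≤ (2 : ℝ) ^ (-δ) := by positivity
  have hr1 : (2 : ℝ) ^ (-δ) < 1 := Real.rpow_lt_one_of_one_lt_of_neg (by norm_num) (by linarith)
  -- `[1, N] ⊆ [1, 2^N)` and the dyadic decomposition
  have hdecomp : ∀ J : ℕ, ∑ g ∈ Ico 1 (2 ^ J), ((g : ℕ) : ℝ) ^ (-(1 + δ)) ≤
      ∑ j ∈ range J, ((2 : ℝ) ^ (-δ)) ^ j := by
    intro J
    induction J with
    | zero => simp
    | succ J ih =>
      rw [← sum_Ico_consecutive _ (Nat.one_le_two_pow) (Nat.pow_le_pow_right (by norm_num) J.le_succ),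
        sum_range_succ]
      exact add_le_add ih (sum_Ico_pow_rpow_neg_le hδ.le J)
  have hgeom : ∀ J : ℕ, ∑ j ∈ range J, ((2 : ℝ) ^ (-δ)) ^ j ≤ 1 / (1 - (2 : ℝ) ^ (-δ)) := fun J ↦ by
    have h := geom_sum_Ico_le_of_lt_one hr0 hr1 (m := 0) (n := J)
    rwa [pow_zero, ← range_eq_Ico] at h
  have hsub : Icc 1 N ⊆ Ico 1 (2 ^ N) := fun g hg ↦ by
    rw [mem_Icc] at hg
    rw [mem_Ico]
    exact ⟨hg.1, lt_of_le_of_lt hg.2 N.lt_two_pow_self⟩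
  calc ∑ g ∈ Icc 1 N, ((g : ℕ) : ℝ) ^ (-(1 + δ)) ≤ ∑ g ∈ Ico 1 (2 ^ N), ((g : ℕ) : ℝ) ^ (-(1 + δ)) :=
        sum_le_sum_of_subset_of_nonneg hsub fun g _ _ ↦ by positivity
    _ ≤ ∑ j ∈ range N, ((2 : ℝ) ^ (-δ)) ^ j := hdecomp N
    _ ≤ 1 / (1 - (2 : ℝ) ^ (-δ)) := hgeom N

/-- **The admissibility constraint of a necklace skeleton, abstract form (registered helper, anchor of this module on
the crux item)**: with at most two cells of `A` in conflict with each good node and at most `β Q ≥ 0` slots of a cell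
blocked by a conflicting node `Q`, the free slots number in total at least `|A| Jz - 2 Σ_Q β Q`
(`sum_card_freeSlots_ge`). -/
theorem skeleton_free_slots : ∀ (A : Finset ℕ) (𝒢 : Finset (ℕ × ℕ)) (Jz : ℕ) (conflict : ℕ → ℕ × ℕ → Bool) (blocked : ℕ → ℕ × ℕ → Finset ℕ) (β : ℕ × ℕ → ℝ), (∀ Q ∈ 𝒢, 0 ≤ β Q) → (∀ m ∈ A, ∀ Q ∈ 𝒢, conflict m Q = true → (((Finset.range Jz).filter (· ∈ blocked m Q)).card : ℝ) ≤ β Q) → (∀ Q ∈ 𝒢, (A.filter fun m ↦ conflict m Q = true).card ≤ 2) → (A.card : ℝ) * Jz - 2 * ∑ Q ∈ 𝒢, β Q ≤ ∑ m ∈ A, (((Finset.range Jz).filter fun z ↦ ∀ Q ∈ 𝒢, conflict m Q = true → z ∉ blocked m Q).card : ℝ) :=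
  fun A 𝒢 Jz conflict blocked β hβ0 hβ hconf ↦
    sum_card_freeSlots_ge A 𝒢 Jz (fun m Q ↦ conflict m Q = true) blocked β hβ0 hβ hconf

end Summit.CriticalPhenomena.CardyFormulaZ2.Cruxes.NestingRigidity.PinchResampling

end
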